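import Summits.AtomisticToContinuum.Crystallization.Theorems.FrustratedLawDichotomyStrainedPatchHomExteriorRayFloor

/-!
# Strained patch, `(H)` hcp exterior certificate (architecture R3) — E3 STEP (3) FOR POSITIVE-FLOOR CHAINS (the nested exterior certificate E2′ / XE / XS): the `hver`
# conclusion at an exterior target `ξ` from the kernel box chain, the cell's slope bound and ONE domination inequality (decomp-a2c hand 2, generation 39; structural #10)

`…HomExteriorRayFloor.hfloor_chain_of_curvChecks` (p854091) supplies the break points and the piecewise floor of `…HomExteriorPieces.hver_of_slabParts_pieces` from a
chain of kernel `curvCheckLJM` facts.  Its last hypothesis `hslab` («if `Λ‖UΔ‖² ≤ (S₇♯ + f₀ + |R|·6⁻⁷)‖UΔ‖` then the leaf conclusion») is what an EXTERIOR target makes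
VACUOUS: `Λ = Σ_k ℓ_k (θ_{k+1} − θ_k)` is a convex combination of the piece floors, so `Λ ≥ ℓmin` whenever every piece floor along the direction `UΔ` is `≥ ℓmin`
(`sum_floor_ge_min`), and then `ℓmin·‖UΔ‖ > S₇♯ + f₀ + |R|·6⁻⁷` contradicts the premise.  Hence:

* ★★★ `hver_exterior_of_curvChecks_uniformFloor` — hypotheses: the label data `B, R, hB, hBin, hR` and the slope bound `hf₀` EXACTLY as in `hver_of_slabParts_pieces`;
  the box chain EXACTLY as in `hfloor_chain_of_curvChecks`; a real `ℓmin` with `hℓ : ∀ k < m, ℓmin·‖UΔ‖² ≤ M_k(UΔ)` (the direction-class floor of each box — for the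
  Bool: `lam_k + (min of Δ̂ᵀD_kΔ̂ over the slab's direction cone)`, critic (s2)/(s4)) and the DOMINATION `hdom : S₇♯ + f₀ + R.card·6⁻⁷ < ℓmin·‖UΔ‖` (for the Bool:
  `ℓmin·ρ_min` with `ρ_min ≤ ‖UΔ‖` from the slab/cell separation, critic (s3)) ⟹ the `hver` conclusion (geometric trichotomy ∨ energy floor) at `(U, ξ)`.
  The signed-floor annulus (β) needs the length-weighted version (`Λ ≥ Σ_k min(ℓ_k,0)·len_k + …`); not in this file.

0 sorry; no definitions; standard axioms.  `--supports stmt-AtomisticToContinuum-27623`.  [folklore chaining]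
-/

noncomputable section

open Set

namespace Summit.AtomisticToContinuum.Crystallization.Theorems.FrustratedLawDichotomyStrainedPatchHomExteriorRay

open scoped BigOperators RealInnerProductSpace
open Literature.Analysis.ValidatedNumerics.Numerics
open Summit.AtomisticToContinuum.Crystallization.Theorems.ChargedEnergyGapNegative (E3)
open Summit.AtomisticToContinuum.Crystallization.Theorems.FrustratedLawDichotomySchurCut (effPot w₄₅ ω₄)
open Summit.AtomisticToContinuum.Crystallization.Theorems.FrustratedLawDichotomyAveragingRuleTightFree (TightNearCap BadNearCap)
open Summit.AtomisticToContinuum.Crystallization.Theorems.FrustratedLawDichotomyExemptAbsorption (ExemptNear)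
open Summit.AtomisticToContinuum.Crystallization.Theorems.FrustratedLawDichotomyStrainedPatchHomSplit (ExRec latPt hexFrame hcpShift)
open Summit.AtomisticToContinuum.Crystallization.Theorems.FrustratedLawDichotomyStrainedPatchTaylorChord (segGd)
open Summit.AtomisticToContinuum.Crystallization.Theorems.FrustratedLawDichotomyStrainedPatchHomCurvLJ (curvCheckLJM)
open Summit.AtomisticToContinuum.Crystallization.Theorems.FrustratedLawDichotomyStrainedPatchHomExteriorTaylor (hver_of_slabParts_pieces)

/-- A convex combination of reals all `≥ ℓmin` is `≥ ℓmin`: `Σ_{k<m} ℓ k (θ (k+1) − θ k) ≥ ℓmin` for monotone break points with `θ 0 = 0`, `θ m = 1`. [arithmetic] -/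
theorem sum_floor_ge_min (m : ℕ) (θ ℓ : ℕ → ℝ) (hθ0 : θ 0 = 0) (hθm : θ m = 1) (hmono : ∀ k, k < m → θ k ≤ θ (k + 1)) {ℓmin : ℝ}
    (hℓ : ∀ k, k < m → ℓmin ≤ ℓ k) : ℓmin ≤ ∑ k ∈ Finset.range m, ℓ k * (θ (k + 1) - θ k) := by
  have htel : ∑ k ∈ Finset.range m, (θ (k + 1) - θ k) = θ m - θ 0 := Finset.sum_range_sub θ m
  have h1 : ∑ k ∈ Finset.range m, ℓmin * (θ (k + 1) - θ k) ≤ ∑ k ∈ Finset.range m, ℓ k * (θ (k + 1) - θ k) := by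
    refine Finset.sum_le_sum fun k hk => ?_
    have hk' := Finset.mem_range.1 hk
    exact mul_le_mul_of_nonneg_right (hℓ k hk') (by linarith [hmono k hk'])
  rw [← Finset.mul_sum, htel, hθm, hθ0, sub_zero, mul_one] at h1
  exact h1

/-- ★★★ **E3 STEP (3), POSITIVE-FLOOR CHAINS: the `hver` conclusion at an exterior target from the kernel box chain, the cell's slope bound and ONE domination inequality.**
[folklore chaining: `hfloor_chain_of_curvChecks` + `sum_floor_ge_min` + `hver_of_slabParts_pieces`, `hslab` vacuous] -/
theorem hver_exterior_of_curvChecks_uniformFloor {μ : ℤ} {U : E3 →L[ℝ] E3} {ξ₀ ξ : E3} (hU : ‖U - 1‖ ≤ 1 / 4) (hn₀ : ‖ξ₀‖ ≤ 1 / 4) (hn : ‖ξ‖ ≤ 1 / 4)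
    (B R : Finset (Fin 3 → ℤ)) (hB : B ⊆ Fintype.piFinset fun _ : Fin 3 => Finset.Icc (-11 : ℤ) 11)
    (hBin : ∀ bb ∈ B, ‖latPt U hexFrame bb + U (hcpShift + ξ)‖ ≤ 7)
    (hR : ∀ bb ∈ (Fintype.piFinset fun _ : Fin 3 => Finset.Icc (-11 : ℤ) 11) \ B, ‖latPt U hexFrame bb + U (hcpShift + ξ)‖ ≤ 7 →
      bb ∈ R ∧ 6 ≤ ‖latPt U hexFrame bb + U (hcpShift + ξ)‖)
    {f₀ : ℝ}
    (hf₀ : |∑ bb ∈ B, (‖latPt U hexFrame bb + U (hcpShift + ξ₀)‖⁻¹ ^ 8 - ‖latPt U hexFrame bb + U (hcpShift + ξ₀)‖⁻¹ ^ 14) *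
        ⟪latPt U hexFrame bb + U (hcpShift + ξ₀), U (ξ - ξ₀)⟫| ≤ f₀ * ‖U (ξ - ξ₀)‖)
    (m : ℕ) (hm : 0 < m) (cs ws : ℕ → ((Fin 3 × Fin 3) ⊕ Fin 3 → ℤ)) (Lc Ln : ℕ → List (Fin 3 → ℤ)) (D : ℕ → Fin 3 → Fin 3 → ℤ) (lam : ℕ → ℤ)
    (hLB : ∀ k, k < m → (Lc k ++ Ln k).toFinset = B) (hnd : ∀ k, k < m → (Lc k ++ Ln k).Nodup)
    (hchk : ∀ k, k < m → curvCheckLJM (cs k) (ws k) (Lc k) (Ln k) (D k) (lam k) = true)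
    (hUbox : ∀ k, k < m → ∀ ab : Fin 3 × Fin 3, |(U (EuclideanSpace.single ab.2 (1 : ℝ))) ab.1 - (cs k (Sum.inl ab) : ℝ) / SC| ≤ (ws k (Sum.inl ab) : ℝ) / SC)
    (hnest : ∀ k, k + 1 < m → ∀ i : Fin 3, cs (k + 1) (Sum.inr i) - ws (k + 1) (Sum.inr i) ≤ cs k (Sum.inr i) - ws k (Sum.inr i) ∧
      cs k (Sum.inr i) + ws k (Sum.inr i) ≤ cs (k + 1) (Sum.inr i) + ws (k + 1) (Sum.inr i))
    (h0 : ∀ i : Fin 3, |ξ₀ i - (cs 0 (Sum.inr i) : ℝ) / SC| ≤ (ws 0 (Sum.inr i) : ℝ) / SC)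
    (h1 : ∀ i : Fin 3, |ξ i - (cs (m - 1) (Sum.inr i) : ℝ) / SC| ≤ (ws (m - 1) (Sum.inr i) : ℝ) / SC) (hΔ : U (ξ - ξ₀) ≠ 0)
    {ℓmin : ℝ}
    (hℓ : ∀ k, k < m → ℓmin * ‖U (ξ - ξ₀)‖ ^ 2 ≤
      (lam k : ℝ) / SC * ‖U (ξ - ξ₀)‖ ^ 2 + ∑ i : Fin 3, ∑ j : Fin 3, (D k i j : ℝ) / SC * ((U (ξ - ξ₀)) i * (U (ξ - ξ₀)) j))
    (hdom : (6000 / 343 * (7 : ℝ)⁻¹ ^ 4 + 2880 / 49 * (7 : ℝ)⁻¹ ^ 5 + 10 / 7 * (7 : ℝ)⁻¹ ^ 6 + 2 * (7 : ℝ)⁻¹ ^ 7) + f₀ + R.card * (6 : ℝ)⁻¹ ^ 7 <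
      ℓmin * ‖U (ξ - ξ₀)‖) :
    (∀ (M : ℕ) (z : Fin M → E3) (cc : Fin M), Function.Injective z →
        Set.range z = {x : E3 | dist x (z cc) ≤ 133 / 10 ∧ ∃ a : Fin 3 → ℤ,
          x = z cc + latPt U hexFrame a ∨ x = z cc + latPt U hexFrame a + U (hcpShift + ξ)} →
        TightNearCap (9 / 5) (3 / 2) z cc ∨ ExemptNear (9 / 5) ExRec z cc ∨ BadNearCap (9 / 5) (3 / 2) z cc) ∨
      (μ : ℝ) / SC ≤ ∑ b ∈ (Fintype.piFinset fun _ : Fin 3 => Finset.Icc (-7 : ℤ) 7).filter (fun b => b ≠ 0), effPot w₄₅ ω₄ (3 / 400) ‖latPt U hexFrame b‖ +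
        ∑ b ∈ (Fintype.piFinset fun _ : Fin 3 => Finset.Icc (-7 : ℤ) 7), effPot w₄₅ ω₄ (3 / 400) ‖latPt U hexFrame b + U (hcpShift + ξ)‖ := by
  obtain ⟨θ, hθ0, hθm, hmono, _hrange, hfloor⟩ :=
    hfloor_chain_of_curvChecks hU hn₀ hn m hm cs ws Lc Ln D lam B hLB hnd hchk hUbox hnest h0 h1 hΔ
  have hpos : 0 < ‖U (ξ - ξ₀)‖ := norm_pos_iff.2 hΔ
  have hn2 : ‖U (ξ - ξ₀)‖ ^ 2 ≠ 0 := pow_ne_zero 2 hpos.ne'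
  -- the piece floors ℓ k := M_k(UΔ)/‖UΔ‖² are all ≥ ℓmin
  set ℓ : ℕ → ℝ := fun k =>
    ((lam k : ℝ) / SC * ‖U (ξ - ξ₀)‖ ^ 2 + ∑ i : Fin 3, ∑ j : Fin 3, (D k i j : ℝ) / SC * ((U (ξ - ξ₀)) i * (U (ξ - ξ₀)) j)) / ‖U (ξ - ξ₀)‖ ^ 2
    with hℓdef
  have hℓge : ∀ k, k < m → ℓmin ≤ ℓ k := by
    intro k hk
    rw [hℓdef]
    simp only
    rw [le_div_iff₀ (pow_pos hpos 2)]
    exact hℓ k hk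
  have hΛ : ℓmin ≤ ∑ k ∈ Finset.range m, ℓ k * (θ (k + 1) - θ k) := sum_floor_ge_min m θ ℓ hθ0 hθm hmono hℓge
  refine hver_of_slabParts_pieces (μ := μ) hU hn₀ hn B R hB hBin hR m θ ℓ hθ0 hθm hmono (f₀ := f₀) (fun k hk s hs => ?_) hf₀ ?_
  · -- hfloor: the chained floor, stated for ℓ k
    have := hfloor k hk s hs
    simpa only [hℓdef] using this
  · -- hslab is vacuous: Λ‖UΔ‖² ≥ ℓmin‖UΔ‖² > (S₇♯ + f₀ + |R|·6⁻⁷)‖UΔ‖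
    intro hq
    exfalso
    have h2 : ℓmin * ‖U (ξ - ξ₀)‖ ^ 2 ≤ (∑ k ∈ Finset.range m, ℓ k * (θ (k + 1) - θ k)) * ‖U (ξ - ξ₀)‖ ^ 2 :=
      mul_le_mul_of_nonneg_right hΛ (sq_nonneg _)
    have h3 : ((6000 / 343 * (7 : ℝ)⁻¹ ^ 4 + 2880 / 49 * (7 : ℝ)⁻¹ ^ 5 + 10 / 7 * (7 : ℝ)⁻¹ ^ 6 + 2 * (7 : ℝ)⁻¹ ^ 7) + f₀ + R.card * (6 : ℝ)⁻¹ ^ 7) *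
        ‖U (ξ - ξ₀)‖ < ℓmin * ‖U (ξ - ξ₀)‖ * ‖U (ξ - ξ₀)‖ := mul_lt_mul_of_pos_right hdom hpos
    nlinarith [h2, h3, hq]

end Summit.AtomisticToContinuum.Crystallization.Theorems.FrustratedLawDichotomyStrainedPatchHomExteriorRay

end
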